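import Literature.Probability.Percolation.CouplingMachine
import Literature.Probability.Percolation.EnhancementProp42
import HarnessLib

/-!
# The `ℋ`-side of the coupling: the exploration read on the copies of the edges of `ℋ` and on the
# mark coins (Martineau–Severo 2019, §5, Step ∞)

Support file of the inline proof of `Literature.Probability.Percolation.MartineauSevero2019_cor22`
(Proposition 4.1). Martineau–Severo (Ann. Probab. 47 (2019), §5): "Let `ω` be a Bernoulli
percolation of parameter `p̂ := 1-(1-p)^{1/M}` on `ℋ̂`, so that `p̂`-percolation on `ℋ̂` corresponds to
`p`-percolation on `ℋ` … By construction, `C_∞` has the distribution of the cluster of the origin for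
the `(p,s)`-process on `ℋ`: it is the cluster of the origin of `((∨_k ω_{e,k})_e, α)` which has
distribution `Ber(p)^{⊗E(ℋ)} ⊗ Ber(s)^{⊗V(ℋ)}`."

Here the machine of `CouplingMachine.lean` is run on the star coins of `CoveringQuotientBlocks.lean`
(`N` copies of every edge coordinate and `N` mark coins per vertex, all `p̂`-coins): an edge query reads
the `N` copies of its edge (open iff some copy is), a bonus reads the `N` mark coins of its vertex
(marked iff all are). We prove that this encoding is good (fresh: every edge is queried once, every
bonus attempted once), that the transcript is consistent with the decoded pair
`(ω, α) = ((∨_k ω_{e,k})_e, (∧_k α_{u,k})_u)`, and hence, by exploration correctness and block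
aggregation (`StarCoins.map_blockOf`), that

  `P_{⊤,p̂}(an explored vertex at distance ≥ L at time K) = ℙ_{p,s}(𝓔_L)`,
  `p = 1-(1-p̂)^N`, `s = p̂^N`, `K ≥ haltBound`

(`Coupling.measureReal_reachState_H`), where `ℙ_{p,s}` is `EnhProp42.enhMeasure`.

## References

* S. Martineau, F. Severo, Ann. Probab. 47 (2019), §5 (Step ∞) [MartineauSevero2019].
-/

noncomputable section

namespace Literature.Probability.Percolation

open MeasureTheory Literature.Barriers.CriticalPhenomena ProbeHistory StarCoins
open scoped Classical

namespace Coupling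

variable {Q : Type*}

/-! ### The encoding on star coins -/

/-- The coin type of the `ℋ`-side: `N` copies of every coordinate of `E(ℋ) ⊔ V(ℋ)`.
[cite: MartineauSevero2019, §5 (E(ℋ̂) = E(ℋ) × {1,…,M})] -/
abbrev CoinH (Q : Type*) (N : ℕ) : Type _ := Carrier (Sym2 Q ⊕ Q) N

/-- The `N` coins of a coordinate. [cite: MartineauSevero2019, §5 (the copies (e, k))] -/
def coinsOf (N : ℕ) (i : Sym2 Q ⊕ Q) : Finset (Sym2 (CoinH Q N)) :=
  Finset.univ.image fun k : Fin N => coin i k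

/-- Membership in `coinsOf`. [folklore] -/
theorem mem_coinsOf {N : ℕ} {i : Sym2 Q ⊕ Q} {c : Sym2 (CoinH Q N)} :
    c ∈ coinsOf N i ↔ ∃ k : Fin N, c = coin i k := by
  simp only [coinsOf, Finset.mem_image, Finset.mem_univ, true_and]
  exact ⟨fun ⟨k, hk⟩ => ⟨k, hk.symm⟩, fun ⟨k, hk⟩ => ⟨k, hk.symm⟩⟩

/-- `|coinsOf N i| = N`. [folklore] -/
theorem card_coinsOf (N : ℕ) (i : Sym2 Q ⊕ Q) : (coinsOf N i).card = N := by
  rw [coinsOf, Finset.card_image_of_injective _ (fun k k' h => (coin_eq_coin_iff.1 h).2), Finset.card_univ,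
    Fintype.card_fin]

/-- Coins of distinct coordinates are disjoint. [folklore] -/
theorem disjoint_coinsOf {N : ℕ} {i j : Sym2 Q ⊕ Q} (h : i ≠ j) : Disjoint (coinsOf N i) (coinsOf N j) := by
  rw [Finset.disjoint_left]
  intro c hc hc'
  obtain ⟨k, rfl⟩ := mem_coinsOf.1 hc
  obtain ⟨k', hk'⟩ := mem_coinsOf.1 hc'
  exact h (coin_eq_coin_iff.1 hk').1

/-- Coins are edges of the complete coin graph. [folklore] -/
theorem coinsOf_subset_edgeSet (N : ℕ) (i : Sym2 Q ⊕ Q) :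
    (↑(coinsOf N i) : Set (Sym2 (CoinH Q N))) ⊆ (⊤ : SimpleGraph (CoinH Q N)).edgeSet := by
  intro c hc
  obtain ⟨k, rfl⟩ := mem_coinsOf.1 hc
  exact coin_mem_edgeSet _ _

/-- **The `ℋ`-side encoding**: an edge query reads the `N` copies of the edge, a bonus reads the `N`
mark coins of the vertex. [cite: MartineauSevero2019, §5 (Step 2K+1 on ℋ̂; s-exploration on ℋ)] -/
def encH (N : ℕ) : List Bool → Query Q → Finset (Sym2 (CoinH Q N))
  | _, Query.edge a b => coinsOf N (Sum.inl s(a, b))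
  | _, Query.bonus u => coinsOf N (Sum.inr u)

variable (H : SimpleGraph Q) [H.LocallyFinite] (o : Q) (r L N : ℕ)

/-- The coins used along a transcript: the copies of the queried edges and the mark coins of the
attempted vertices. [cite: MartineauSevero2019, §5 (the p-explored edges and s-explored vertices)] -/
def usedH (b : List Bool) : Finset (Sym2 (CoinH Q N)) :=
  (stateOf H o r L N b).Qd.biUnion (fun e => coinsOf N (Sum.inl e)) ∪
    (stateOf H o r L N b).Y.biUnion (fun u => coinsOf N (Sum.inr u))

variable {H o r L N}

/-- Membership in `usedH`. [folklore] -/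
theorem mem_usedH {b : List Bool} {c : Sym2 (CoinH Q N)} :
    c ∈ usedH H o r L N b ↔ (∃ e ∈ (stateOf H o r L N b).Qd, c ∈ coinsOf N (Sum.inl e)) ∨
      (∃ u ∈ (stateOf H o r L N b).Y, c ∈ coinsOf N (Sum.inr u)) := by
  simp [usedH]

/-- **The `ℋ`-side encoding is good** (fresh: an edge is queried at most once and a bonus attempted
at most once, so their coins were never read). [cite: MartineauSevero2019, §5 ("No vertex or edge will get explored more than once")] -/
theorem goodEnc_H : TExplore.GoodEnc (machine H o r L N) (encH N) (⊤ : SimpleGraph (CoinH Q N)) := by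
  refine TExplore.goodEnc_of_used (usedH H o r L N) ?_ ?_ ?_ ?_
  · intro b q _
    cases q with
    | edge a c => exact coinsOf_subset_edgeSet N _
    | bonus u => exact coinsOf_subset_edgeSet N _
  · intro b q _
    cases q with
    | edge a c => exact card_coinsOf N _
    | bonus u => exact card_coinsOf N _
  · intro b q ans hq
    have hq' : nq H o r L (stateOf H o r L N b) = some q := hq
    have h1 : encH N b q ⊆ usedH H o r L N (ans :: b) := by
      intro c hc
      rw [mem_usedH, stateOf_cons_of_some hq']
      cases q with
      | edge a d =>
        exact Or.inl ⟨s(a, d), mem_Qd_hstep_edge.2 (Or.inl rfl), hc⟩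
      | bonus u =>
        exact Or.inr ⟨u, mem_Y_hstep_bonus.2 (Or.inl rfl), hc⟩
    have h2 : usedH H o r L N b ⊆ usedH H o r L N (ans :: b) := by
      intro c hc
      obtain ⟨mA, mQd, mO, mY, -⟩ := mono_cons (H := H) (o := o) (r := r) (L := L) (N := N) ans b
      rw [mem_usedH]
      rcases mem_usedH.1 hc with ⟨e, he, hce⟩ | ⟨u, hu, hcu⟩
      · exact Or.inl ⟨e, mQd he, hce⟩
      · exact Or.inr ⟨u, mY hu, hcu⟩
    convert Finset.union_subset h1 h2 using 3
  · intro b q hq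
    have hq' : nq H o r L (stateOf H o r L N b) = some q := hq
    rw [Finset.disjoint_left]
    intro c hc hcu
    rcases mem_usedH.1 hcu with ⟨e, he, hce⟩ | ⟨u, hu, hcu⟩
    · cases q with
      | edge a d =>
        obtain ⟨-, -, -, hQ⟩ := nq_edge_spec hq'
        have hne : (Sum.inl s(a, d) : Sym2 Q ⊕ Q) ≠ Sum.inl e := fun h => hQ (by cases h; exact he)
        exact Finset.disjoint_left.1 (disjoint_coinsOf hne) hc hce
      | bonus u' =>
        exact Finset.disjoint_left.1 (disjoint_coinsOf (Sum.inr_ne_inl : (Sum.inr u' : Sym2 Q ⊕ Q) ≠ Sum.inl e)) hc hce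
    · cases q with
      | edge a d =>
        exact Finset.disjoint_left.1 (disjoint_coinsOf (Sum.inl_ne_inr : (Sum.inl s(a, d) : Sym2 Q ⊕ Q) ≠ Sum.inr u)) hc hcu
      | bonus u' =>
        obtain ⟨-, -, -, hY, -⟩ := nq_bonus_spec hq'
        have hne : (Sum.inr u' : Sym2 Q ⊕ Q) ≠ Sum.inr u := fun h => hY (by cases h; exact hu)
        exact Finset.disjoint_left.1 (disjoint_coinsOf hne) hc hcu

/-! ### Decoding and consistency -/

variable (H N) in
/-- The `ℋ`-side aggregator: an edge coordinate is open iff it is an edge of `ℋ` and some copy is open;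
a vertex is marked iff all its mark coins are open. [cite: MartineauSevero2019, §5 ("(∨_k ω_{e,k})_e", "α")] -/
def aggH : Sym2 Q ⊕ Q → (Fin N → Prop) → Prop
  | Sum.inl e, h => e ∈ H.edgeSet ∧ ∃ k, h k
  | Sum.inr _, h => ∀ k, h k

variable (H N) in
/-- The decoded joint configuration `(ω, α)` of a coin configuration. [cite: MartineauSevero2019, §5 (Step ∞)] -/
def decodeH (ω : Set (Sym2 (CoinH Q N))) : Set (Sym2 Q ⊕ Q) := blockOf (aggH H N) ω

omit [H.LocallyFinite] in
/-- Decoded edges: an edge of `ℋ` one of whose copies is open. [folklore] -/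
theorem mem_enhOmega_decodeH {ω : Set (Sym2 (CoinH Q N))} {e : Sym2 Q} :
    e ∈ enhOmega (decodeH H N ω) ↔ e ∈ H.edgeSet ∧ ∃ k : Fin N, coin (Sum.inl e : Sym2 Q ⊕ Q) k ∈ ω := by
  rw [mem_enhOmega, decodeH, mem_blockOf, aggH]

omit [H.LocallyFinite] in
/-- Decoded marks: all mark coins open. [folklore] -/
theorem mem_enhAlpha_decodeH {ω : Set (Sym2 (CoinH Q N))} {u : Q} :
    u ∈ enhAlpha (decodeH H N ω) ↔ ∀ k : Fin N, coin (Sum.inr u : Sym2 Q ⊕ Q) k ∈ ω := by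
  rw [mem_enhAlpha, decodeH, mem_blockOf, aggH]

/-- Some coin of a coordinate is observed open iff some copy is open. [folklore] -/
theorem obs_coinsOf_nonempty_iff {ω : Set (Sym2 (CoinH Q N))} {i : Sym2 Q ⊕ Q} :
    (obs ω (coinsOf N i)).Nonempty ↔ ∃ k : Fin N, coin i k ∈ ω := by
  constructor
  · rintro ⟨c, hc⟩
    rw [mem_obs_iff] at hc
    obtain ⟨k, rfl⟩ := mem_coinsOf.1 hc.1
    exact ⟨k, hc.2⟩
  · rintro ⟨k, hk⟩
    exact ⟨coin i k, mem_obs_iff.2 ⟨mem_coinsOf.2 ⟨k, rfl⟩, hk⟩⟩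

/-- All coins of a coordinate are observed open iff all copies are open. [folklore] -/
theorem obs_coinsOf_eq_iff {ω : Set (Sym2 (CoinH Q N))} {i : Sym2 Q ⊕ Q} :
    obs ω (coinsOf N i) = coinsOf N i ↔ ∀ k : Fin N, coin i k ∈ ω := by
  constructor
  · intro h k
    have : coin i k ∈ obs ω (coinsOf N i) := by rw [h]; exact mem_coinsOf.2 ⟨k, rfl⟩
    exact (mem_obs_iff.1 this).2
  · intro h
    ext c
    rw [mem_obs_iff]
    constructor
    · exact fun hc => hc.1
    · intro hc
      obtain ⟨k, rfl⟩ := mem_coinsOf.1 hc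
      exact ⟨hc, h k⟩

/-- The encoding of an edge query. [folklore] -/
theorem encH_edge {b : List Bool} {a c : Q} : encH N b (Query.edge a c) = coinsOf N (Sum.inl s(a, c)) := rfl

/-- The encoding of a bonus query. [folklore] -/
theorem encH_bonus {b : List Bool} {u : Q} : encH N b (Query.bonus u) = coinsOf N (Sum.inr u) := rfl

/-- The recorded answer to an edge query: some probed coin open. [folklore] -/
theorem answer_edge_eq_true_iff {a c : Q} {D : Finset (Sym2 (CoinH Q N))} {ω : Set (Sym2 (CoinH Q N))} :
    TExplore.answer (machine H o r L N) (Query.edge a c) (D, obs ω D) = true ↔ (obs ω D).Nonempty := by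
  simp [TExplore.answer, machine]

/-- The recorded answer to a bonus query: all probed coins open. [folklore] -/
theorem answer_bonus_eq_true_iff {u : Q} {D : Finset (Sym2 (CoinH Q N))} {ω : Set (Sym2 (CoinH Q N))} :
    TExplore.answer (machine H o r L N) (Query.bonus u) (D, obs ω D) = true ↔ obs ω D = D := by
  simp [TExplore.answer, machine]

/-- **The transcript is consistent with the decoded pair** `((∨_k ω_{e,k})_e, (∧_k α_{u,k})_u)` along
every run of the `ℋ`-side. [cite: MartineauSevero2019, §5 (Step ∞: "it is the cluster of the origin of ((∨_k ω_{e,k})_e, α)")] -/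
theorem consistent_bt_H (ω : Set (Sym2 (CoinH Q N))) (k : ℕ) :
    Consistent (H := H) (o := o) (r := r) (L := L) (N := N) (enhOmega (decodeH H N ω)) (enhAlpha (decodeH H N ω))
      (TExplore.bt (machine H o r L N) ((TExplore.texpl (machine H o r L N) (encH N)).hist k ω)) := by
  induction k with
  | zero => simp [Consistent]
  | succ k ih =>
    cases hq : nq H o r L (stateOf H o r L N (TExplore.bt (machine H o r L N)
        ((TExplore.texpl (machine H o r L N) (encH N)).hist k ω))) with
    | none =>
      rw [TExplore.bt_hist_succ_of_none goodEnc_H hq]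
      exact ih
    | some q =>
      rw [TExplore.bt_hist_succ_of_some goodEnc_H hq]
      refine ⟨ih, ?_⟩
      rw [hq]
      cases q with
      | edge a c =>
        obtain ⟨-, hac, -, -⟩ := nq_edge_spec hq
        simp only
        rw [encH_edge, answer_edge_eq_true_iff, obs_coinsOf_nonempty_iff, mem_enhOmega_decodeH]
        exact ⟨fun h => ⟨hac, h⟩, fun h => h.2⟩
      | bonus u =>
        simp only
        rw [encH_bonus, answer_bonus_eq_true_iff, obs_coinsOf_eq_iff, mem_enhAlpha_decodeH]

/-! ### The law: `P_{⊤,p̂}(reach) = ℙ_{p,s}(𝓔_L)` -/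

omit [H.LocallyFinite] in
/-- The block probabilities of the `ℋ`-side aggregator are the parameters
`(1-(1-p̂)^N on E(ℋ), 0 off E(ℋ), p̂^N on vertices)`. [cite: MartineauSevero2019, §5 (p̂; s)] -/
theorem blockMeasure_aggH (ph : unitInterval) (i : Sym2 Q ⊕ Q) :
    blockMeasure ph N {h | aggH H N i h} =
      unitInterval.toNNReal (EnhProp42.enhParams H (orParam ph N) (andParam ph N) i) := by
  cases i with
  | inl e =>
    by_cases he : e ∈ H.edgeSet
    · have : {h : Fin N → Prop | aggH H N (Sum.inl e) h} = {h | ∃ k, h k} := by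
        ext h; simp [aggH, he]
      rw [this, blockMeasure_exists]
      simp [EnhProp42.enhParams, he]
    · have : {h : Fin N → Prop | aggH H N (Sum.inl e) h} = ∅ := by
        ext h; simp [aggH, he]
      rw [this, measure_empty]
      simp only [EnhProp42.enhParams, Sum.elim_inl, if_neg he, unitInterval.toNNReal_zero, ENNReal.coe_zero]
  | inr u =>
    have : {h : Fin N → Prop | aggH H N (Sum.inr u) h} = {h | ∀ k, h k} := by
      ext h; simp [aggH]
    rw [this, blockMeasure_forall]
    simp [EnhProp42.enhParams]

omit [H.LocallyFinite] in
/-- **The decoded configuration is `ℙ_{p,s}`-distributed**, `p = 1-(1-p̂)^N`, `s = p̂^N`.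
[cite: MartineauSevero2019, §5 (Step ∞: "which has distribution Ber(p)^{⊗E(ℋ)} ⊗ Ber(s)^{⊗V(ℋ)}")] -/
theorem map_decodeH (ph : unitInterval) :
    (bondPercolation (⊤ : SimpleGraph (CoinH Q N)) ph).map (decodeH H N) =
      EnhProp42.enhMeasure H (orParam ph N) (andParam ph N) := by
  rw [EnhProp42.enhMeasure]
  exact map_blockOf ph (aggH H N) _ (blockMeasure_aggH ph)

/-- **The `ℋ`-side law**: for `K ≥ haltBound`, the probability that the exploration read on the coins of
`ℋ̂` has explored a vertex at distance `≥ L` equals `ℙ_{p,s}(𝓔_L)`.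
[cite: MartineauSevero2019, §5 (Step ∞) and Proposition 4.1] -/
theorem measureReal_reachState_H [Countable Q] (hH : H.Connected) (ph : unitInterval) {K : ℕ}
    (hK : haltBound H o r L ≤ K) :
    (bondPercolation (⊤ : SimpleGraph (CoinH Q N)) ph).real
        {ω | ReachState H o L (stateOf H o r L N (TExplore.bt (machine H o r L N)
          ((TExplore.texpl (machine H o r L N) (encH N)).hist K ω)))} =
      (EnhProp42.enhMeasure H (orParam ph N) (andParam ph N)).real (enhEvent H r o L) := by
  have hset : {ω : Set (Sym2 (CoinH Q N)) | ReachState H o L (stateOf H o r L N (TExplore.bt (machine H o r L N)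
      ((TExplore.texpl (machine H o r L N) (encH N)).hist K ω)))} = decodeH H N ⁻¹' enhEvent H r o L := by
    ext ω
    rw [Set.mem_setOf_eq, Set.mem_preimage, mem_enhEvent_iff]
    exact reachState_iff_of_halted hH (consistent_bt_H ω K) (nq_stateOf_bt_eq_none hH goodEnc_H hK ω)
  have hmeas : Measurable (decodeH H N) := measurable_blockOf _
  rw [hset, ← map_measureReal_apply hmeas (determinedBy_enhEvent_enhWindow hH r o L).measurableSet_of_finset,
    map_decodeH]

end Coupling

end Literature.Probability.Percolation
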